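import Mathlib
import Summits.Langlands.Langlands.Theses.ParityBlindBianchi
import Summits.Langlands.Langlands.Theorems.ParityBlindBianchiIcosahedralQuadraticDescentFrobRoots
import Literature.NumberTheory.Automorphic.TunnellLemma
import Literature.NumberTheory.Automorphic.AutomorphicRepsGLSatakeFlathProofs

/-!
# Icosahedral descent, base-change-conditional (crux `IcosahedralDescentLevelBC`, line `Sketch`) —
the read-off at a split place

Uniform quadratic descent for an Artin representation `ρ : Γ_ℚ → GL₂(ℂ)`, the read-off step, with
Arthur–Clozel's strong lifting at the unramified places taken not as the named Literature fact but
as clause (b) of the route crux `QuadraticBaseChangeGL2` (its `n = 2` specialisation).  `K/ℚ` is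
quadratic Galois, `x` cuspidal on `GL₂(𝔸_ℚ)`, `P` cuspidal on `GL₂(𝔸_K)` a weak base-change lift
of `x` (`IsWeakBaseChangeLiftAE`); `v` is a finite place of `ℚ` unramified in `K` and split (every
`w ∣ v` has residue degree `1`), `ρ` is unramified at `v`, and `P` is Frobenius–Satake compatible
with `ρ|_{Γ_K}` at every `w ∣ v`.  Then `x` is Frobenius–Satake compatible with `ρ` at `v`:
clause (b) makes the weak lift exact at `v` (`x` unramified at `v` with parameter `α₀`, and
`t_{P,w} = α₀^{f(w|v)} = α₀`), while `satakeParam_eq_frob_pow` gives `t_{P,w} = β^{f(w|v)} = β`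
for the Frobenius eigenvalues `β = frobRoots ρ v`; hence `α₀ = β`.
-/

-- `Summit.Langlands.Langlands.…`: the repeated path component is the tree's layout (D-0017).
set_option linter.dupNamespace false

noncomputable section

open scoped MatrixGroups NumberField Polynomial Classical
open NumberField IsDedekindDomain Field Filter
open Literature.NumberTheory.Automorphic Literature.NumberTheory.GaloisRepresentations
open Summit.Langlands.Langlands.Theorems.IcosahedralQuadraticDescent
open Summit.Langlands.Langlands.Theses.ParityBlindBianchi

namespace Summit.Langlands.Langlands.Theorems.IcosahedralDescentLevelBC

/-- **Strong lifting read at a split place (base-change-conditional form).**  If `P` (cuspidal on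
`GL₂(𝔸_K)`, `K/ℚ` quadratic Galois) is a weak base-change lift of the cuspidal `x` on `GL₂(𝔸_ℚ)`,
`v` is unramified in `K` with all places above it of residue degree `1`, `ρ` is unramified at `v`,
and `P` is Frobenius–Satake compatible with `ρ|_{Γ_K}` at every place above `v`, then `x` is
Frobenius–Satake compatible with `ρ` at `v` — assuming clause (b) of `QuadraticBaseChangeGL2`
(Arthur–Clozel III.5.1 at `n = 2`: `t_{P,w} = t_{x,v}^{f(w|v)} = t_{x,v}` at every `w ∣ v`, and
`t_{P,w} = β_v^{f(w|v)} = β_v` for the Frobenius eigenvalues `β_v` of `ρ` at `v`). [folklore] -/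
theorem stub_readOffBC (hQBC : QuadraticBaseChangeGL2) (ρ : FramedArtinRep ℚ 2)
    (K : Type) [Field K] [NumberField K] [IsGalois ℚ K] (h2 : Module.finrank ℚ K = 2)
    (hQ : isCompact_glFiniteIntegralLevel 2 ℚ) (hK : isCompact_glFiniteIntegralLevel 2 K)
    (x : CuspidalAutomorphicRepData 2 ℚ hQ) (P : CuspidalAutomorphicRepData 2 K hK)
    (hlift : IsWeakBaseChangeLiftAE x.1 P.1) (v : HeightOneSpectrum (𝓞 ℚ))
    (hunr : Algebra.IsUnramifiedIn (𝓞 K) v.asIdeal)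
    (hdeg : ∀ w : HeightOneSpectrum (𝓞 K), w.asIdeal.under (𝓞 ℚ) = v.asIdeal →
      w.asIdeal.inertiaDeg (𝓞 ℚ) = 1)
    (hρ : ρ.IsUnramifiedAt v)
    (hcompat : ∀ w : HeightOneSpectrum (𝓞 K), w.asIdeal.under (𝓞 ℚ) = v.asIdeal →
      FrobSatakeCompatibleAt (ρ.restrictField K) P.1 w) :
    FrobSatakeCompatibleAt ρ x.1 v := by
  -- adapted from `IcosahedralDescentLevel.frobSatakeCompatibleAt_of_weakLift_split`
  -- (`Theorems/ParityBlindBianchiIcosahedralDescentLevelReadOff.lean`), with the named fact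
  -- `ArthurClozel1989_strongLifting_unramified` replaced by clause (b) of `QuadraticBaseChangeGL2`.
  -- (a) `x` is unramified at `v`: `P` is unramified at every `w ∣ v` (clause (b), (ii))
  obtain ⟨α₀, hα₀⟩ : x.1.IsUnramifiedAt v :=
    (hQBC.2.1 ℚ K h2 hQ hK x P hlift).2 v hunr fun w hw =>
      (hcompat w hw).imp fun _ h => h.1
  -- (b) at a place `w ∣ v`: `t_{P,w} = α₀^{f(w|v)}` (clause (b), (i))
  obtain ⟨w, hw⟩ := exists_above (E := K) v
  have hPw := (hQBC.2.1 ℚ K h2 hQ hK x P hlift).1 w v α₀ hw hunr hα₀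
  -- (c) `t_{P,w} = β^{f(w|v)}` for the Frobenius eigenvalues `β` of `ρ` at `v`, and `f(w|v) = 1`
  obtain ⟨hβcard, hPv⟩ := card_frobRoots_and_hasFrobCharpolyAt ρ hρ
  have e := satakeParam_eq_frob_pow ρ hρ hβcard hPv
    (AutomorphicRepData.hasSatakeParamAt_unique_holds P.1) hw (hcompat w hw) hPw
  rw [hdeg w hw] at e
  simp only [pow_one, Multiset.map_id'] at e
  exact ⟨frobRoots ρ v, e ▸ hα₀, hρ, hPv⟩

end Summit.Langlands.Langlands.Theorems.IcosahedralDescentLevelBC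

end
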